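import Summits.Ventures.CertifiedManyBodySolver.Observables.PairLROTowerCeilingAuxReading
import Summits.Ventures.CertifiedManyBodySolver.Observables.RungLeavesPairAnchor
import HarnessLib

/-!
# The ANCHOR-RAY transport in summit-leaf format: `ObsPairLROCeilingAt t′ U n c` at a TARGET point from one anchor node,
# one cap and one floor («BOX1-A0T-CHORD» leaf shape)

HONEST FRAMING: first certified bounds on pairing observables; not a superconductivity verdict; a ceiling route,
never presence; nothing in this file is a number. Crew hubbard-obs (D-0042), seat hubbard-obs-p1
(`prover-hubbard-obs-p1-g14-0`); pen RULING (hq) d261 (hq2). Zero compute; no definition; no named fact; no `sorry`.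

* **`ObsPairLROCeilingAt_of_anchor_orbitState_bound_ray`** — d-wave form factor, a point group `S ∋` (nonempty) with
  `b1gSign = 1` on `S`; an ANCHOR one-point node at `θ₀ = (1, t′₀, U₀)` in the orbit-state shape of the typed OP1-E
  claim nodes (`cert_obsOP1E_…_up`: all `L ≥ L₁` fitting the window, all unit `ζ`), `κ ≥ 0`; a TARGET `θ = (1, t′, U)`
  (`U ≥ 0`), a ray scale `s > 0` and the ray point `θ₁ = (1, t′₁, U₁)` (`U₁ ≥ 0`) with `θ₀ = θ + s(θ − θ₁)`; a cap
  `e(θ; n) ≤ cap` and a floor `lo ≤ e(θ₁; n)` (`0 < n < 2`); and `(c − A − κ[(cap − u₀) + s(cap − lo)] + (Σμ)(n/2 − ν))² ≤ c'`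
  ⇒ `ObsPairLROCeilingAt t′ U n c'` (RungLeavesPairAnchor's generic summit-format pair-LRO ceiling). One line per box
  corner; the box word is the corner maximum (cap affine, `−lo` convex, `θ₁` affine in `θ`).
References: T. Koma, H. Tasaki, J. Stat. Phys. 76 (1994) 745, Theorem 5 [KomaTasaki1994]; D. J. Scalapino, Phys. Rep. 250
(1995) 329, §2 eq. (2.4) [Scalapino1995].
-/

noncomputable section

namespace Summit.Ventures.CertifiedManyBodySolver.Observables

open Matrix Complex Finset Literature.MathematicalPhysics.QuantumLattice Literature.Probability.LatticeModels
open Literature.MathematicalPhysics.QuantumLattice.HubbardWave0 ThermodynamicLimit Filter Topology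
open Literature.MathematicalPhysics.QuantumManyBody.StateRelaxation
open Summit.Ventures.CertifiedManyBodySolver.Transport
open scoped ComplexOrder ComplexConjugate BigOperators

/-- **Summit-leaf form of the anchor-ray transport** (`d`-wave): an anchor OP1-E node at `θ₀ = (1, t′₀, U₀)`, a cap at the
target `θ = (1, t′, U)` and a floor at the ray point `θ₁ = (1, t′₁, U₁)`, `θ₀ = θ + s(θ − θ₁)`, give
`ObsPairLROCeilingAt t′ U n c'` for every rational `c' ≥ (c − A − κ[(cap − u₀) + s(cap − lo)] + (Σ_σ μ_σ)(n/2 − ν))²`.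
[cite: KomaTasaki1994, Theorem 5] [cite: Scalapino1995, §2 eq. (2.4)] -/
theorem ObsPairLROCeilingAt_of_anchor_orbitState_bound_ray {t'₀ U₀ t' U t'₁ U₁ s n : ℝ} {c' : ℚ}
    (hU : 0 ≤ U) (hU₁ : 0 ≤ U₁) (hs : 0 < s) (hn0 : 0 < n) (hn2 : n < 2)
    (ht' : t'₀ = t' + s * (t' - t'₁)) (hUr : U₀ = U + s * (U - U₁))
    {c A κ u₀ ν cap lo : ℝ} (μ : Fin 2 → ℝ) (hκ : 0 ≤ κ)
    (hcap : energyDensityTT' 1 t' U n ≤ cap) (hlo : lo ≤ energyDensityTT' 1 t'₁ U₁ n)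
    {S : Finset (DihedralGroup 4)} (hS : S.Nonempty) (hS1 : ∀ γ ∈ S, b1gSign γ = 1)
    {Λ' : Finset (Site 2)} (h0 : pairRegion (insert (0 : Site 2) unitSteps) 0 ⊆ Λ') (L₁ : ℕ)
    (hInj : ∀ L : ℕ, L₁ ≤ L → Set.InjOn (Torus.proj (d := 2) L) ↑Λ')
    (hbound : ∀ (L : ℕ) [NeZero L] (hL : L₁ ≤ L) (ζ : Fock (Orb (FermionTorus 2 L))), star ζ ⬝ᵥ ζ = 1 →
      c - A + ∑ σ : Fin 2, μ σ *
          ((star ζ ⬝ᵥ ((∑ y : FermionTorus 2 L, numberOp y σ) *ᵥ ζ)).re / (L : ℝ) ^ 2 - ν) +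
        κ * (u₀ - (star ζ ⬝ᵥ (hubbardTorusTT' L 1 t'₀ U₀ *ᵥ ζ)).re / (L : ℝ) ^ 2) ≤
        (orbitState (spaceGroupUnitary S) ζ (fermionEmbed (PolySite.toTorusEmb L (hInj L hL))
          (-(fermionEmbed (PolySite.incl h0)
            (localPairAt (insert (0 : Site 2) unitSteps) dWaveFormFactor 0))))).re)
    (hc' : (c - A - κ * ((cap - u₀) + s * (cap - lo)) + (∑ σ : Fin 2, μ σ) * (n / 2 - ν)) ^ 2 ≤ ((c' : ℚ) : ℝ)) :
    ObsPairLROCeilingAt t' U n c' := by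
  intro ψ hψ hψ1
  have hg : ∀ γ ∈ S, ∀ e ∈ insert (0 : Site 2) unitSteps, dWaveFormFactor (d4Vec γ e) = dWaveFormFactor e :=
    fun γ hγ e _ => dWaveFormFactor_d4Vec_of_b1gSign_eq_one (hS1 γ hγ) e
  exact (liminf_pairFieldLRO_le_sq_of_anchor_orbitState_bound_ray_TT' dWaveFormFactor 1 hU hU₁ hs hn0 hn2 ht' hUr
    μ hκ hcap hlo hS hg h0 L₁ hInj hbound ψ hψ hψ1).trans hc'

end Summit.Ventures.CertifiedManyBodySolver.Observables

end
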